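import Summits.Ventures.HodgeRepro2.T5SU11LegendreRodrigues
import Summits.Ventures.HodgeRepro2.T5SU11LegendreZeros
import Summits.Ventures.HodgeRepro2.T5SU11LegendreOrthogonalLower
import Summits.Ventures.HodgeRepro2.T5SU11LegendreOrthogonal

/-!
# The moments of the Legendre polynomials: `∫_{−1}^{1} t^m P_n(t) dt`

Rodrigues' formula `2ⁿ n! P_n = Dⁿ (X² − 1)ⁿ` (row 390) and `n` integrations by parts — the boundary terms vanish
because `Dᵏ (X² − 1)ⁿ` vanishes at `±1` for `k < n` (row 400) — give, for every polynomial `q`,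

  **`∫ q · Dⁿ(X² − 1)ⁿ = (−1)ⁿ ∫ Dⁿq · (X² − 1)ⁿ`**   (`integral_mul_iterate_derivative_rod`),

hence the MOMENT FORMULA, for `m ≥ n`,

  **`∫_{−1}^{1} t^m P_n(t) dt = (m!/(m − n)!) / (2ⁿ n!) · ∫_{−1}^{1} t^{m−n} (1 − t²)ⁿ dt`**   (`integral_pow_mul_legP`),

so the moments vanish for `m < n` (`integral_pow_mul_legP_eq_zero_of_lt`, row 406) and for `m + n` odd
(`integral_pow_mul_legP_eq_zero_of_odd`, parity), and are POSITIVE for `m ≥ n` with `m − n` even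
(`integral_pow_mul_legP_pos`); the first non-zero moment is **`∫ tⁿ P_n = 2/((2n + 1) lc_n) = 2ⁿ⁺¹ (n!)²/(2n + 1)!`**
(`integral_pow_self_mul_legP`, via the orthogonality of rows 383/406). Nothing is claimed about (N).

Blind lane: Mathlib + the HodgeRepro2 prefix only; no sorry; axioms ⊆ {propext, Classical.choice,
Quot.sound}.
-/

namespace Summit.Ventures.HodgeRepro2.T5SU11LegendreMoments

open Polynomial intervalIntegral Finset Filter Topology MeasureTheory
open Set (Icc Ioc Ioo uIcc uIoc)
open T5SU11SphericalLegendreAll T5SU11SphericalLegendreLaplace T5SU11JacobiPhaseLawEven T5SU11JacobiLegendreLeading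
  T5SU11LegendreIdentities T5SU11LegendreOrthogonal T5SU11LegendreOrthogonalLower T5SU11LegendreRodrigues
  T5SU11LegendreZeros

/-! ### `n` integrations by parts against `Dⁿ (X² − 1)ⁿ` -/

/-- The `j`-fold integration by parts: `∫ q · Dⁿ R = (−1)^j ∫ Dʲq · Dⁿ⁻ʲ R` for `j ≤ n`, `R = (X² − 1)ⁿ`. -/
theorem integral_mul_iterate_derivative_rod_aux (n : ℕ) (q : ℝ[X]) :
    ∀ j, j ≤ n → ∫ t in (-1 : ℝ)..1, q.eval t * (derivative^[n] (((X : ℝ[X]) ^ 2 - 1) ^ n)).eval t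
      = (-1) ^ j * ∫ t in (-1 : ℝ)..1,
          (derivative^[j] q).eval t * (derivative^[n - j] (((X : ℝ[X]) ^ 2 - 1) ^ n)).eval t := by
  intro j
  induction j with
  | zero => intro _; simp
  | succ j ih =>
    intro hj
    rw [ih (Nat.le_of_succ_le hj)]
    obtain ⟨m, hm⟩ : ∃ m, n - j = m + 1 := ⟨n - j - 1, by omega⟩
    have hm' : n - (j + 1) = m := by omega
    rw [hm, hm']
    -- integrate by parts: `u = Dʲq`, `v = Dᵐ R`, `v′ = Dᵐ⁺¹ R`
    have hu : ∀ x ∈ uIcc (-1 : ℝ) 1, HasDerivAt (fun t => (derivative^[j] q).eval t)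
        ((derivative^[j + 1] q).eval x) x := fun x _ => by
      rw [Function.iterate_succ_apply']
      exact Polynomial.hasDerivAt _ x
    have hv : ∀ x ∈ uIcc (-1 : ℝ) 1, HasDerivAt (fun t => (derivative^[m] (((X : ℝ[X]) ^ 2 - 1) ^ n)).eval t)
        ((derivative^[m + 1] (((X : ℝ[X]) ^ 2 - 1) ^ n)).eval x) x := fun x _ => by
      rw [Function.iterate_succ_apply']
      exact Polynomial.hasDerivAt _ x
    have hu' : IntervalIntegrable (fun t => (derivative^[j + 1] q).eval t) volume (-1 : ℝ) 1 :=
      (Polynomial.continuous _).intervalIntegrable _ _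
    have hv' : IntervalIntegrable (fun t => (derivative^[m + 1] (((X : ℝ[X]) ^ 2 - 1) ^ n)).eval t) volume
        (-1 : ℝ) 1 := (Polynomial.continuous _).intervalIntegrable _ _
    have h := integral_mul_deriv_eq_deriv_mul hu hv hu' hv'
    have hm_lt : m < n := by omega
    rw [eval_one_iterate_derivative_rodPoly n hm_lt, eval_neg_one_iterate_derivative_rodPoly n hm_lt, mul_zero,
      mul_zero, sub_zero, zero_sub] at h
    rw [h, pow_succ]
    ring

/-- **`∫ q · Dⁿ(X² − 1)ⁿ = (−1)ⁿ ∫ Dⁿq · (X² − 1)ⁿ`** for every polynomial `q`. -/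
theorem integral_mul_iterate_derivative_rod (n : ℕ) (q : ℝ[X]) :
    ∫ t in (-1 : ℝ)..1, q.eval t * (derivative^[n] (((X : ℝ[X]) ^ 2 - 1) ^ n)).eval t
      = (-1) ^ n * ∫ t in (-1 : ℝ)..1, (derivative^[n] q).eval t * (t ^ 2 - 1) ^ n := by
  rw [integral_mul_iterate_derivative_rod_aux n q n le_rfl, Nat.sub_self]
  simp only [Function.iterate_zero, id_eq, eval_pow, eval_sub, eval_X, eval_one]

/-! ### The moment formula -/

/-- **THE MOMENT FORMULA**: `∫ t^m P_n = (m!/(m − n)!)/(2ⁿ n!) · ∫ t^{m−n} (1 − t²)ⁿ` (`m.descFactorial n =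
m!/(m − n)!`, which vanishes for `m < n`; the formula holds for every `m, n`). -/
theorem integral_pow_mul_legP (m n : ℕ) :
    ∫ t in (-1 : ℝ)..1, t ^ m * legP n t
      = (m.descFactorial n : ℝ) / ((2 : ℝ) ^ n * n.factorial)
        * ∫ t in (-1 : ℝ)..1, t ^ (m - n) * (1 - t ^ 2) ^ n := by
  have hne : ((2 : ℝ) ^ n * n.factorial) ≠ 0 := by positivity
  have e1 : ∫ t in (-1 : ℝ)..1, t ^ m * legP n t
      = (1 / ((2 : ℝ) ^ n * n.factorial)) * ∫ t in (-1 : ℝ)..1,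
          (X ^ m : ℝ[X]).eval t * (derivative^[n] (((X : ℝ[X]) ^ 2 - 1) ^ n)).eval t := by
    rw [← intervalIntegral.integral_const_mul]
    refine integral_congr fun t _ => ?_
    rw [legP_eq_rodrigues, eval_pow, eval_X]
    field_simp
  rw [e1, integral_mul_iterate_derivative_rod, iterate_derivative_X_pow_eq_C_mul]
  simp only [eval_mul, eval_C, eval_pow, eval_X]
  have e2 : ∀ t : ℝ, (m.descFactorial n : ℝ) * t ^ (m - n) * (t ^ 2 - 1) ^ n
      = (-1) ^ n * ((m.descFactorial n : ℝ) * (t ^ (m - n) * (1 - t ^ 2) ^ n)) := fun t => by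
    have : (t ^ 2 - 1) ^ n = (-1) ^ n * (1 - t ^ 2) ^ n := by
      rw [← mul_pow]
      ring
    rw [this]
    ring
  simp_rw [e2]
  rw [intervalIntegral.integral_const_mul, intervalIntegral.integral_const_mul]
  set I := ∫ t in (-1 : ℝ)..1, t ^ (m - n) * (1 - t ^ 2) ^ n with hI
  have hsq : ((-1 : ℝ) ^ n) * ((-1 : ℝ) ^ n) = 1 := by
    rw [← mul_pow]
    norm_num
  calc 1 / ((2 : ℝ) ^ n * n.factorial) * ((-1) ^ n * ((-1) ^ n * ((m.descFactorial n : ℝ) * I)))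
      = 1 / ((2 : ℝ) ^ n * n.factorial) * ((-1) ^ n * (-1) ^ n) * ((m.descFactorial n : ℝ) * I) := by ring
    _ = (m.descFactorial n : ℝ) / ((2 : ℝ) ^ n * n.factorial) * I := by
        rw [hsq]
        ring

/-- The moments vanish below the degree: `∫ t^m P_n = 0` for `m < n` (row 406). -/
theorem integral_pow_mul_legP_eq_zero_of_lt {m n : ℕ} (h : m < n) : ∫ t in (-1 : ℝ)..1, t ^ m * legP n t = 0 := by
  have := integral_eval_mul_legP_eq_zero_of_natDegree_lt (n := n) (q := X ^ m) (by rw [natDegree_X_pow]; exact h)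
  simpa only [eval_pow, eval_X] using this

/-- `∫ t^m P_n = (−1)^{m+n} ∫ t^m P_n` (the substitution `t ↦ −t`). -/
theorem integral_pow_mul_legP_parity (m n : ℕ) :
    ∫ t in (-1 : ℝ)..1, t ^ m * legP n t = (-1) ^ (m + n) * ∫ t in (-1 : ℝ)..1, t ^ m * legP n t := by
  have h := integral_comp_neg (a := (-1 : ℝ)) (b := 1) (f := fun t => t ^ m * legP n t)
  simp only [neg_neg] at h
  conv_lhs => rw [← h]
  rw [← intervalIntegral.integral_const_mul]
  refine integral_congr fun t _ => ?_
  rw [legP_neg, neg_pow, pow_add]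
  ring

/-- **The moments vanish for `m + n` odd**: `∫ t^m P_n = 0` whenever `m + n` is odd. -/
theorem integral_pow_mul_legP_eq_zero_of_odd {m n : ℕ} (h : Odd (m + n)) :
    ∫ t in (-1 : ℝ)..1, t ^ m * legP n t = 0 := by
  have := integral_pow_mul_legP_parity m n
  rw [h.neg_one_pow] at this
  linarith

/-- `∫_{−1}^{1} t^{2a} (1 − t²)ⁿ dt > 0`. -/
theorem integral_pow_mul_one_sub_sq_pos (a n : ℕ) :
    0 < ∫ t in (-1 : ℝ)..1, t ^ (2 * a) * (1 - t ^ 2) ^ n := by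
  refine intervalIntegral.integral_pos (by norm_num) (by fun_prop) (fun t ht => ?_) ⟨1 / 2, by norm_num, ?_⟩
  · have h1 : 0 ≤ t ^ (2 * a) := by
      rw [pow_mul]
      exact pow_nonneg (sq_nonneg t) a
    have h2 : 0 ≤ (1 - t ^ 2) ^ n := by
      refine pow_nonneg ?_ n
      nlinarith [ht.1, ht.2]
    exact mul_nonneg h1 h2
  · positivity

/-- **The moments are positive for `m ≥ n` with `m − n` even.** -/
theorem integral_pow_mul_legP_pos {m n : ℕ} (h : n ≤ m) (he : Even (m - n)) :
    0 < ∫ t in (-1 : ℝ)..1, t ^ m * legP n t := by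
  rw [integral_pow_mul_legP]
  obtain ⟨a, ha⟩ := he
  rw [ha, show a + a = 2 * a by ring]
  have hd : (0 : ℝ) < (m.descFactorial n : ℝ) := by
    exact_mod_cast Nat.descFactorial_pos.mpr h
  exact mul_pos (div_pos hd (by positivity)) (integral_pow_mul_one_sub_sq_pos a n)

/-- The moments are non-negative for `m ≥ n`. -/
theorem integral_pow_mul_legP_nonneg {m n : ℕ} (h : n ≤ m) : 0 ≤ ∫ t in (-1 : ℝ)..1, t ^ m * legP n t := by
  rcases Nat.even_or_odd (m - n) with he | ho
  · exact (integral_pow_mul_legP_pos h he).le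
  · have : Odd (m + n) := by
      obtain ⟨a, ha⟩ := ho
      exact ⟨a + n, by omega⟩
    rw [integral_pow_mul_legP_eq_zero_of_odd this]

/-! ### The first non-zero moment -/

/-- **`∫ tⁿ P_n = 2/((2n + 1) lc_n)`** (`tⁿ = P_n/lc_n + lower degree`, rows 383/406). -/
theorem integral_pow_self_mul_legP (n : ℕ) :
    ∫ t in (-1 : ℝ)..1, t ^ n * legP n t = 2 / ((2 * (n : ℝ) + 1) * legLead n) := by
  have hL := legLead_pos n
  -- `X^n − (1/lc) P_n` has degree `< n`
  set r : ℝ[X] := X ^ n - C (legLead n)⁻¹ * legPoly n with hr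
  have hrdeg : r.natDegree < n ∨ r = 0 := by
    by_cases h0 : r = 0
    · exact Or.inr h0
    · left
      have hcoef : r.coeff n = 0 := by
        simp only [hr, coeff_sub, coeff_X_pow, if_true, coeff_C_mul, coeff_legPoly_self]
        rw [inv_mul_cancel₀ hL.ne', sub_self]
      have hdeg : r.natDegree ≤ n := by
        refine (natDegree_sub_le _ _).trans (max_le (natDegree_X_pow_le n) ?_)
        exact (natDegree_C_mul_le _ _).trans (natDegree_legPoly n).le
      rcases hdeg.lt_or_eq with hlt | heq
      · exact hlt
      · exfalso
        have := leadingCoeff_ne_zero.mpr h0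
        rw [leadingCoeff, heq] at this
        exact this hcoef
  have hrint : ∫ t in (-1 : ℝ)..1, r.eval t * legP n t = 0 := by
    rcases hrdeg with hlt | h0
    · exact integral_eval_mul_legP_eq_zero_of_natDegree_lt hlt
    · simp [h0]
  have e : ∀ t, t ^ n * legP n t = r.eval t * legP n t + (legLead n)⁻¹ * (legP n t * legP n t) := fun t => by
    simp only [hr, eval_sub, eval_mul, eval_pow, eval_X, eval_C, ← legP_eq_eval]
    ring
  simp_rw [e]
  have i1 : IntervalIntegrable (fun t => r.eval t * legP n t) volume (-1 : ℝ) 1 :=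
    ((Polynomial.continuous r).mul (continuous_legP n)).intervalIntegrable _ _
  have i2 : IntervalIntegrable (fun t => (legLead n)⁻¹ * (legP n t * legP n t)) volume (-1 : ℝ) 1 :=
    (((continuous_legP n).mul (continuous_legP n)).const_mul _).intervalIntegrable _ _
  rw [integral_add i1 i2, hrint, zero_add, intervalIntegral.integral_const_mul]
  have h2 := integral_legP_sq n
  simp_rw [sq] at h2
  rw [h2]
  have hne : (2 * (n : ℝ) + 1) ≠ 0 := by positivity
  field_simp

/-- `∫ tⁿ P_n = 2ⁿ⁺¹ (n!)²/(2n + 1)!`. -/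
theorem integral_pow_self_mul_legP' (n : ℕ) :
    ∫ t in (-1 : ℝ)..1, t ^ n * legP n t = 2 ^ (n + 1) * (n.factorial : ℝ) ^ 2 / ((2 * n + 1).factorial : ℝ) := by
  rw [integral_pow_self_mul_legP, legLead]
  have h1 : ((2 * n + 1).factorial : ℝ) = (2 * (n : ℝ) + 1) * ((2 * n).factorial : ℝ) := by
    rw [Nat.factorial_succ]
    push_cast
    ring
  rw [h1]
  have hne1 : ((2 * n).factorial : ℝ) ≠ 0 := by positivity
  have hne2 : (2 * (n : ℝ) + 1) ≠ 0 := by positivity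
  have hne3 : (n.factorial : ℝ) ≠ 0 := by positivity
  field_simp
  ring

end Summit.Ventures.HodgeRepro2.T5SU11LegendreMoments
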